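import Summits.ValiantsHypothesis.ValiantsHypothesis.Theorems.LacunarySymmetroidMatrixDescartesDoorA26WallBubblingConfluentClusters
import Summits.ValiantsHypothesis.ValiantsHypothesis.Theorems.LacunarySymmetroidMatrixDescartesDoorA26WallBubblingConfluentSlots
import Summits.ValiantsHypothesis.ValiantsHypothesis.Theorems.LacunarySymmetroidMatrixDescartesDoorA26WallBubblingClusterRungs
import Summits.ValiantsHypothesis.ValiantsHypothesis.Theorems.LacunarySymmetroidMatrixDescartesDoorA26WallBubblingChainCeilingTight
import Summits.ValiantsHypothesis.ValiantsHypothesis.Theorems.LacunarySymmetroidMatrixDescartesDoorA26WallBubblingConfluentTower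

/-!
# Wall bubbling for `DoorA26` — (W-split) structure, part B3: THE TIGHT-CHAIN STRUCTURE THEOREM (every accumulation of twenties at a generic Weyl face is a tight confluent chain)

HONEST FRAMING.  Chain theorem for obligation (W) `stub_weylFaces` of `Cruxes/DoorA26/Lines/wall_bubbling.lean` (stmt-ValiantsHypothesis-19979
`DoorA26`; OPEN, typed, never asserted), W2 seat val-sym-door-p1 g15; statement file `Cruxes/DoorA26/Lines/wall_bubbling_ConfluentDoor.lean` rev 4,
named residual «(W-split) multi-scale linking» (register R2761).  g14 README «Next (1)»: the TIGHT-CHAIN STRUCTURE theorem.  DOOR-FREE.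

THE THEOREM (`tightChain`).  Genuine `(2,6)` pencils `f_ν(t) = det Σ_l e^{δ^ν_l t}U^ν_l ≢ 0` (symmetric letters), exponents `δ^ν → δ0` on the GENERIC
part of a Weyl face (positions `0, 5`: `δ0 5 = δ0 0`, `δ0 ∘ castSucc` 2-Sidon), each with twenty zeros `z^ν_0 < ⋯ < z^ν_19` anywhere.  Then along one
subsequence the data of part A (`confluentClusters`: clusters `c < C` with zero counts `m c` — the block sizes of the twenty DISTINCT zeros, so
`Σ_c m c = 20` IS their number; centres drifting apart; the `m c` recentred zeros in a common window; per cluster the Gram-normalised confluent limit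
`Γ_c = ε_c·polar(W_c, W_c)`, confluent det of `W_c ≢ 0`, continuous convergence with all derivatives) satisfy, with `V` = the pair-sum values of `δ0`,
`Λ_c` = values carrying an alive member `polar(W_c p, W_c q) ≠ 0`, and the member-language degrees `d_c w ∈ {0,1,2}` of part B1:
* `V.card = 15`;
* **every cluster is Laguerre–Pólya-SHARP**: `m c + 1 = Σ_{w ∈ Λ_c}(d_c w + 1)` (W1 #12 + W2 #5 give `≤`; the squeeze gives `=`);
* **tropical monotonicity** (member form): `c < c'`, `polar(W_c p, W_c q) ≠ 0`, `polar(W_{c'} p', W_{c'} q') ≠ 0 ⇒ δ0 p + δ0 q ≤ δ0 p' + δ0 q'`;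
* **the chain of active sets is TIGHT**: `Σ_c (|Λ_c| − 1) = 14` (equality in B9's interval count: the `Λ_c` cover all fifteen values and consecutive
  clusters share exactly one);
* **slot splitting is TIGHT**: for every value `w`, `Σ_c [w ∈ Λ_c]·d_c w = n_w − 1` — the two confluent degrees of the triple `2δ0 0` are shared out
  exactly (`2 + 0`, or `1 + 1` in two clusters), and EACH of the four doubleton `t`-slots `polar(T_c, S_{c,k})` is alive in EXACTLY ONE cluster.
Inputs: A `confluentClusters`; B1 `confluentDet_zerosWithMultiplicityLE_slots` + W2 #5 `multiplicity_transfer_iteratedDeriv` (hcount); B2 `clusters_monotone`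
(hmono), `clusters_doubleton_split` / `clusters_triple_top` / `clusters_triple_mid` / `clusters_triple_three` (hsplit); #17 `chain_ceiling` and its
EQUALITY CASE `chain_ceiling_tight` (part B0 `…ChainCeilingTight`).  WHAT IT IS NOT: it does not exclude tight chains — `chain_ceiling_attained_two_clusters` (#17) shows the
bookkeeping is consistent; their exclusion is the OPEN pencil-level residual (W-split) (END-DEFICIT doors `ConfluentDoor26TopDeficit/BottomDeficit`,
middle splits, broken chains).  With the door `ConfluentDoor26` one gets `C ≥ 2` (#16); not restated here.

No new definitions; nothing here bears on `DoorA26`, `MatrixDescartes` (stmt-ValiantsHypothesis-18050) or `VP ≠ VNP`; (W)/(W-split)/`ConfluentDoor26` OPEN.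

[folklore] double counting, equality cases.  [this work] the structure theorem.
-/

-- `Summit.ValiantsHypothesis.ValiantsHypothesis.…` repeats a component by the D-0017 layout
-- (single-conjunct summit), which the `dupNamespace` linter flags; the name is mandated.
set_option linter.dupNamespace false

namespace Summit.ValiantsHypothesis.ValiantsHypothesis.Theorems.LacunarySymmetroidMatrixDescartes.WallBubbling

open Finset Filter Topology Polynomial
open Bubbling (polar polar_comm card_pairSums_five)
open Literature.Analysis.TotalPositivity.LaguerreRuleOfSigns (ZerosWithMultiplicityLE)
open scoped BigOperators

/-! ## 3. The tight-chain structure theorem -/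

/-- **THE TIGHT-CHAIN STRUCTURE THEOREM** (door-free).  See the module docstring.  Hypotheses = those of `confluentClusters`; conclusions = its
conclusions (one subsequence, clusters, centres, recentred zeros, Gram-normalisation packages) AND the tightness of the chain: `|V| = 15`, every cluster
Laguerre–Pólya-sharp, tropical monotonicity in member form, tight interval count `Σ_c (|Λ_c| − 1) = 14`, tight slot splitting per value. [this work] -/
theorem tightChain (δs : ℕ → Fin 6 → ℝ) (δ0 : Fin 6 → ℝ)
    (hδ : ∀ l, Tendsto (fun ν => δs ν l) atTop (𝓝 (δ0 l))) (h05 : δ0 5 = δ0 0)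
    (hsid : ∀ a b c d : Fin 5, δ0 a.castSucc + δ0 b.castSucc = δ0 c.castSucc + δ0 d.castSucc → (a = c ∧ b = d) ∨ (a = d ∧ b = c))
    (U : ℕ → Fin 6 → Matrix (Fin 2) (Fin 2) ℝ) (hU : ∀ ν l, (U ν l).IsSymm)
    (hne : ∀ ν, ∃ t, (∑ l, Real.exp (δs ν l * t) • U ν l).det ≠ 0)
    (z : ℕ → Fin 20 → ℝ) (hz : ∀ ν, StrictMono (z ν)) (hroot : ∀ ν i, (∑ l, Real.exp (δs ν l * z ν i) • U ν l).det = 0) :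
    ∃ φ : ℕ → ℕ, StrictMono φ ∧
    ∃ (C : ℕ) (m : Fin C → ℕ) (s : Fin C → ℕ → ℝ) (R : ℝ)
      (μ : Fin C → ℕ → ℝ) (Γ : Fin C → Fin 6 → Fin 6 → ℝ) (ε : Fin C → ℝ) (W : Fin C → Fin 6 → Matrix (Fin 2) (Fin 2) ℝ),
      ∑ c, m c = 20 ∧ (∀ c, 1 ≤ m c) ∧
      (∀ c c' : Fin C, c < c' → Tendsto (fun k => s c' k - s c k) atTop atTop) ∧
      (∀ (c : Fin C) (k : ℕ), ∃ x : Fin (m c) → ℝ, StrictMono x ∧ ∀ i, x i ∈ Set.Icc (-R) R ∧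
        (∑ l, Real.exp (δs (φ k) l * x i) • (Real.exp (δs (φ k) l * s c k) • U (φ k) l)).det = 0) ∧
      (∀ c : Fin C,
        (∀ k, 0 < μ c k) ∧
        (∀ k a b, |polar
          (if a = 0 then Real.exp (δs (φ k) 0 * s c k) • U (φ k) 0 + Real.exp (δs (φ k) 5 * s c k) • U (φ k) 5
            else if a = 5 then (δs (φ k) 5 - δs (φ k) 0) • (Real.exp (δs (φ k) 5 * s c k) • U (φ k) 5)
            else Real.exp (δs (φ k) a * s c k) • U (φ k) a)
          (if b = 0 then Real.exp (δs (φ k) 0 * s c k) • U (φ k) 0 + Real.exp (δs (φ k) 5 * s c k) • U (φ k) 5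
            else if b = 5 then (δs (φ k) 5 - δs (φ k) 0) • (Real.exp (δs (φ k) 5 * s c k) • U (φ k) 5)
            else Real.exp (δs (φ k) b * s c k) • U (φ k) b)| ≤ μ c k) ∧
        (∀ a b, Tendsto (fun k => polar
          (if a = 0 then Real.exp (δs (φ k) 0 * s c k) • U (φ k) 0 + Real.exp (δs (φ k) 5 * s c k) • U (φ k) 5
            else if a = 5 then (δs (φ k) 5 - δs (φ k) 0) • (Real.exp (δs (φ k) 5 * s c k) • U (φ k) 5)
            else Real.exp (δs (φ k) a * s c k) • U (φ k) a)
          (if b = 0 then Real.exp (δs (φ k) 0 * s c k) • U (φ k) 0 + Real.exp (δs (φ k) 5 * s c k) • U (φ k) 5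
            else if b = 5 then (δs (φ k) 5 - δs (φ k) 0) • (Real.exp (δs (φ k) 5 * s c k) • U (φ k) 5)
            else Real.exp (δs (φ k) b * s c k) • U (φ k) b) / μ c k) atTop (𝓝 (Γ c a b))) ∧
        (ε c = 1 ∨ ε c = -1) ∧ (∀ l, (W c l).IsSymm) ∧ (∀ a b, Γ c a b = ε c * polar (W c a) (W c b)) ∧
        (∃ t, ((Real.exp (δ0 0 * t)) • (W c 0 + t • W c 5)
          + ∑ k : Fin 4, (Real.exp (δ0 k.succ.castSucc * t)) • W c k.succ.castSucc).det ≠ 0) ∧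
        ∀ (n : ℕ) (ψ : ℕ → ℕ), StrictMono ψ → ∀ (ts : ℕ → ℝ) (t₀ : ℝ), Tendsto ts atTop (𝓝 t₀) →
          Tendsto (fun k => iteratedDeriv n
              (fun t => ε c * (μ c (ψ k))⁻¹ *
                (∑ l, Real.exp (δs (φ (ψ k)) l * t) • (Real.exp (δs (φ (ψ k)) l * s c (ψ k)) • U (φ (ψ k)) l)).det) (ts k))
            atTop (𝓝 (iteratedDeriv n
              (fun t => ((Real.exp (δ0 0 * t)) • (W c 0 + t • W c 5)
          + ∑ k : Fin 4, (Real.exp (δ0 k.succ.castSucc * t)) • W c k.succ.castSucc).det) t₀))) ∧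
      -- TIGHTNESS
      ((univ : Finset (Fin 6 × Fin 6)).image (fun pq => δ0 pq.1 + δ0 pq.2)).card = 15 ∧
      (∀ c : Fin C, m c + 1 = ∑ w ∈ ((univ : Finset (Fin 6 × Fin 6)).image (fun pq => δ0 pq.1 + δ0 pq.2)).filter
          (fun w => (∃ p q : Fin 6, δ0 p + δ0 q = w ∧ polar (W c p) (W c q) ≠ 0)),
        ((if δ0 0 + δ0 0 = w ∧ polar (W c 5) (W c 5) ≠ 0 then 2 else if (∃ q : Fin 6, q ≠ 5 ∧ δ0 5 + δ0 q = w ∧ polar (W c 5) (W c q) ≠ 0) then 1 else 0) + 1)) ∧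
      (∀ c c' : Fin C, c < c' → ∀ p q p' q' : Fin 6,
        polar (W c p) (W c q) ≠ 0 → polar (W c' p') (W c' q') ≠ 0 → δ0 p + δ0 q ≤ δ0 p' + δ0 q') ∧
      (∑ c : Fin C, ((((univ : Finset (Fin 6 × Fin 6)).image (fun pq => δ0 pq.1 + δ0 pq.2)).filter
          (fun w => (∃ p q : Fin 6, δ0 p + δ0 q = w ∧ polar (W c p) (W c q) ≠ 0))).card - 1) = 14) ∧
      (∀ w ∈ ((univ : Finset (Fin 6 × Fin 6)).image (fun pq => δ0 pq.1 + δ0 pq.2)),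
        (∑ c : Fin C, if (∃ p q : Fin 6, δ0 p + δ0 q = w ∧ polar (W c p) (W c q) ≠ 0)
          then (if δ0 0 + δ0 0 = w ∧ polar (W c 5) (W c 5) ≠ 0 then 2 else if (∃ q : Fin 6, q ≠ 5 ∧ δ0 5 + δ0 q = w ∧ polar (W c 5) (W c q) ≠ 0) then 1 else 0) else 0)
        = (if w = δ0 0 + δ0 0 then 3 else if (∃ q : Fin 6, q ≠ 0 ∧ q ≠ 5 ∧ w = δ0 0 + δ0 q) then 2 else 1) - 1) := by
  classical
  obtain ⟨φ, hφ, C, m, s, R, hm, hmpos, hdrift, hzeros, μ, Γ, ε, W, hpkg⟩ := confluentClusters δs δ0 hδ h05 hsid U hU hne z hz hroot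
  have hμ : ∀ c k, 0 < μ c k := fun c => (hpkg c).1
  have hdom := fun c => (hpkg c).2.1
  have hΓ := fun c => (hpkg c).2.2.1
  have hε : ∀ c, ε c = 1 ∨ ε c = -1 := fun c => (hpkg c).2.2.2.1
  have hΓW : ∀ c a b, Γ c a b = ε c * polar (W c a) (W c b) := fun c => (hpkg c).2.2.2.2.2.1
  have hneW := fun c => (hpkg c).2.2.2.2.2.2.1
  have hconv := fun c => (hpkg c).2.2.2.2.2.2.2
  have hδφ : ∀ l, Tendsto (fun k => δs (φ k) l) atTop (𝓝 (δ0 l)) := fun l => (hδ l).comp hφ.tendsto_atTop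
  -- alive members are the non-zero entries of `Γ`
  have hεne : ∀ c, ε c ≠ 0 := by
    intro c; rcases hε c with h | h <;> rw [h] <;> norm_num
  have hal : ∀ c p q, polar (W c p) (W c q) ≠ 0 ↔ Γ c p q ≠ 0 := by
    intro c p q
    rw [hΓW]
    exact ⟨fun h => mul_ne_zero (hεne c) h, fun h hz0 => h (by rw [hz0, mul_zero])⟩
  have hΓsymm : ∀ c a b, Γ c a b = Γ c b a := by
    intro c a b; rw [hΓW, hΓW, polar_comm]
  -- the rungs in cluster currency
  have Rmono : ∀ c c' : Fin C, c < c' → ∀ p q p' q' : Fin 6, Γ c p q ≠ 0 → Γ c' p' q' ≠ 0 → δ0 p + δ0 q ≤ δ0 p' + δ0 q' :=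
    fun c c' hcc' p q p' q' h1 h2 => clusters_monotone (fun k => δs (φ k)) δ0 hδφ h05 (fun k => U (φ k)) s μ Γ hμ hdom hΓ
      c c' (hdrift c c' hcc') p q p' q' h1 h2
  have Rdbl : ∀ c c' : Fin C, c < c' → ∀ k : Fin 6, k ≠ 0 → k ≠ 5 → Γ c 5 k ≠ 0 → Γ c' 5 k ≠ 0 → False :=
    fun c c' hcc' k hk0 hk5 h1 h2 => clusters_doubleton_split (fun k => δs (φ k)) δ0 hδφ h05 (fun k => U (φ k)) s μ Γ hμ hdom hΓ
      c c' (hdrift c c' hcc') k hk0 hk5 h1 h2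
  have Rtop : ∀ c c' : Fin C, c < c' → Γ c 5 5 ≠ 0 → Γ c' 5 5 = 0 ∧ Γ c' 0 5 = 0 :=
    fun c c' hcc' h1 => clusters_triple_top (fun k => δs (φ k)) δ0 hδφ h05 (fun k => U (φ k)) s μ Γ hμ hdom hΓ
      c c' (hdrift c c' hcc') h1
  have Rmid : ∀ c c' : Fin C, c < c' → Γ c 0 5 ≠ 0 → Γ c' 5 5 = 0 :=
    fun c c' hcc' h1 => clusters_triple_mid (fun k => δs (φ k)) δ0 hδφ h05 (fun k => U (φ k)) s μ Γ hμ hdom hΓ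
      c c' (hdrift c c' hcc') h1
  have Rthree : ∀ c₁ c₂ c₃ : Fin C, c₁ < c₂ → c₂ < c₃ → Γ c₁ 0 5 ≠ 0 → Γ c₂ 0 5 ≠ 0 → Γ c₃ 0 5 ≠ 0 → False :=
    fun c₁ c₂ c₃ h12 h23 h1 h2 h3 => clusters_triple_three (fun k => δs (φ k)) δ0 hδφ h05 (fun k => U (φ k)) s μ Γ hμ hdom hΓ
      c₁ c₂ c₃ (hdrift c₁ c₂ h12) (hdrift c₂ c₃ h23) h1 h2 h3
  -- the value set
  set V : Finset ℝ := ((univ : Finset (Fin 6 × Fin 6)).image (fun pq => δ0 pq.1 + δ0 pq.2)) with hV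
  have hmemV : ∀ p q : Fin 6, δ0 p + δ0 q ∈ V := fun p q => Finset.mem_image.mpr ⟨(p, q), Finset.mem_univ _, rfl⟩
  -- |V| ≤ 15
  have hV15 : V.card ≤ 15 := by
    have hρ : ∀ l : Fin 6, δ0 l = δ0 (Fin.castSucc ⟨(l : ℕ) % 5, Nat.mod_lt _ (by norm_num)⟩) := by
      intro l
      fin_cases l
      · rfl
      · rfl
      · rfl
      · rfl
      · rfl
      · exact h05
    have hsub : V ⊆ (univ : Finset (Fin 5 × Fin 5)).image (fun pr => δ0 pr.1.castSucc + δ0 pr.2.castSucc) := by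
      intro w hw
      rw [hV, Finset.mem_image] at hw
      obtain ⟨pq, -, rfl⟩ := hw
      exact Finset.mem_image.mpr ⟨(⟨(pq.1 : ℕ) % 5, Nat.mod_lt _ (by norm_num)⟩, ⟨(pq.2 : ℕ) % 5, Nat.mod_lt _ (by norm_num)⟩),
        Finset.mem_univ _, by rw [← hρ, ← hρ]⟩
    exact (Finset.card_le_card hsub).trans (card_pairSums_five (fun mm => δ0 mm.castSucc)).1
  -- Σ_V (n w − 1) ≤ 6
  have hn6 : (∑ w ∈ V, ((if w = δ0 0 + δ0 0 then 3 else if (∃ q : Fin 6, q ≠ 0 ∧ q ≠ 5 ∧ w = δ0 0 + δ0 q) then 2 else 1) - 1)) ≤ 6 := by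
    set D : Finset ℝ := ((univ : Finset (Fin 6)).filter (fun q => q ≠ 0 ∧ q ≠ 5)).image (fun q => δ0 0 + δ0 q) with hD
    have hDcard : D.card ≤ 4 := by
      refine Finset.card_image_le.trans ?_
      have : ((univ : Finset (Fin 6)).filter (fun q => q ≠ 0 ∧ q ≠ 5)).card = 4 := by decide
      rw [this]
    have hterm : ∀ w ∈ V, ((if w = δ0 0 + δ0 0 then 3 else if (∃ q : Fin 6, q ≠ 0 ∧ q ≠ 5 ∧ w = δ0 0 + δ0 q) then 2 else 1) - 1)
        ≤ (if w = δ0 0 + δ0 0 then 2 else 0) + (if w ∈ D then 1 else 0) := by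
      intro w _
      by_cases h1 : w = δ0 0 + δ0 0
      · rw [if_pos h1, if_pos h1]; omega
      · rw [if_neg h1, if_neg h1]
        by_cases h2 : ∃ q : Fin 6, q ≠ 0 ∧ q ≠ 5 ∧ w = δ0 0 + δ0 q
        · obtain ⟨q, hq0, hq5, hwq⟩ := h2
          have hwD : w ∈ D := by
            rw [hD, Finset.mem_image]
            exact ⟨q, Finset.mem_filter.mpr ⟨Finset.mem_univ _, hq0, hq5⟩, hwq.symm⟩
          rw [if_pos ⟨q, hq0, hq5, hwq⟩, if_pos hwD]
        · rw [if_neg h2]; exact Nat.zero_le _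
    refine (Finset.sum_le_sum hterm).trans ?_
    rw [Finset.sum_add_distrib, Finset.sum_ite_eq', Finset.sum_boole, Nat.cast_id]
    have hf : (V.filter (fun w => w ∈ D)).card ≤ 4 :=
      (Finset.card_le_card (fun w hw => (Finset.mem_filter.mp hw).2)).trans hDcard
    split_ifs <;> omega
  -- (hne) every cluster has an alive member
  have hne' : ∀ c : Fin C, (V.filter (fun w => (∃ p q : Fin 6, δ0 p + δ0 q = w ∧ polar (W c p) (W c q) ≠ 0))).Nonempty := by
    intro c
    obtain ⟨p, q, hpq⟩ := exists_polar_ne_zero_of_confluentDet_ne_zero δ0 (W c) (hneW c)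
    exact ⟨δ0 p + δ0 q, Finset.mem_filter.mpr ⟨hmemV p q, p, q, rfl, hpq⟩⟩
  -- (hcount) the Laguerre–Pólya count per cluster, through the multiplicity transfer
  have hcount : ∀ c : Fin C, m c + 1 ≤ ∑ w ∈ V.filter (fun w => (∃ p q : Fin 6, δ0 p + δ0 q = w ∧ polar (W c p) (W c q) ≠ 0)),
      ((if δ0 0 + δ0 0 = w ∧ polar (W c 5) (W c 5) ≠ 0 then 2 else if (∃ q : Fin 6, q ≠ 5 ∧ δ0 5 + δ0 q = w ∧ polar (W c 5) (W c q) ≠ 0) then 1 else 0) + 1) := by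
    intro c
    obtain ⟨Z, mult, hZ, hmZ⟩ := multiplicity_transfer_iteratedDeriv (N := m c) (-R) R
      (fun k t => ε c * (μ c k)⁻¹ * (∑ l, Real.exp (δs (φ k) l * t) • (Real.exp (δs (φ k) l * s c k) • U (φ k) l)).det)
      (fun t => ((Real.exp (δ0 0 * t)) • (W c 0 + t • W c 5)
          + ∑ k : Fin 4, (Real.exp (δ0 k.succ.castSucc * t)) • W c k.succ.castSucc).det)
      (fun k nn => contDiff_const.mul (contDiff_pencilDet _ _ nn))
      (fun j _ ψ hψ ts t₀ _ hts => hconv c j ψ hψ ts t₀ hts)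
      (fun k => by
        obtain ⟨x, hx, hx'⟩ := hzeros c k
        exact ⟨x, hx, fun i => ⟨(hx' i).1, by rw [(hx' i).2, mul_zero]⟩⟩)
    have hLP := confluentDet_zerosWithMultiplicityLE_slots δ0 h05 (W c) (hneW c) Z mult
      (fun z' hz' => ⟨Set.mem_univ _, (hZ z' hz').2⟩)
    have hS1 : 1 ≤ ∑ w ∈ V.filter (fun w => (∃ p q : Fin 6, δ0 p + δ0 q = w ∧ polar (W c p) (W c q) ≠ 0)),
        ((if δ0 0 + δ0 0 = w ∧ polar (W c 5) (W c 5) ≠ 0 then 2 else if (∃ q : Fin 6, q ≠ 5 ∧ δ0 5 + δ0 q = w ∧ polar (W c 5) (W c q) ≠ 0) then 1 else 0) + 1) := by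
      obtain ⟨w₀, hw₀⟩ := hne' c
      exact le_trans (Nat.le_add_left 1 _) (Finset.single_le_sum
        (f := fun w => (if δ0 0 + δ0 0 = w ∧ polar (W c 5) (W c 5) ≠ 0 then 2 else if (∃ q : Fin 6, q ≠ 5 ∧ δ0 5 + δ0 q = w ∧ polar (W c 5) (W c q) ≠ 0) then 1 else 0) + 1) (fun w _ => Nat.zero_le _) hw₀)
    have hmZ' : m c ≤ ∑ z' ∈ Z, mult z' := hmZ
    have hLP' : ∑ z' ∈ Z, mult z' ≤ (∑ w ∈ V.filter (fun w => (∃ p q : Fin 6, δ0 p + δ0 q = w ∧ polar (W c p) (W c q) ≠ 0)),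
        ((if δ0 0 + δ0 0 = w ∧ polar (W c 5) (W c 5) ≠ 0 then 2 else if (∃ q : Fin 6, q ≠ 5 ∧ δ0 5 + δ0 q = w ∧ polar (W c 5) (W c q) ≠ 0) then 1 else 0) + 1)) - 1 := hLP
    omega
  -- (hmono) tropical monotonicity of the active value sets
  have hmono' : ∀ c c' : Fin C, c < c' →
      ∀ w ∈ V.filter (fun w => (∃ p q : Fin 6, δ0 p + δ0 q = w ∧ polar (W c p) (W c q) ≠ 0)), ∀ w' ∈ V.filter (fun w => (∃ p q : Fin 6, δ0 p + δ0 q = w ∧ polar (W c' p) (W c' q) ≠ 0)), w ≤ w' := by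
    intro c c' hcc' w hw w' hw'
    obtain ⟨-, p, q, rfl, hpq⟩ := Finset.mem_filter.mp hw
    obtain ⟨-, p', q', rfl, hp'q'⟩ := Finset.mem_filter.mp hw'
    exact Rmono c c' hcc' p q p' q' ((hal c p q).mp hpq) ((hal c' p' q').mp hp'q')
  -- dictionary: an alive confluent `t`-slot of value `2δ0 0` is the slot `(0,5)`
  have hq0 : ∀ c : Fin C, (∃ q : Fin 6, q ≠ 5 ∧ δ0 5 + δ0 q = δ0 0 + δ0 0 ∧ polar (W c 5) (W c q) ≠ 0) → Γ c 0 5 ≠ 0 := by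
    rintro c ⟨q, hq5, hq, hpol⟩
    have hq' : q = 0 := weyl_pos_inj δ0 hsid 0 q (by decide) hq5 (by rw [h05] at hq; linarith)
    subst hq'
    rw [hΓsymm]; exact (hal c 5 0).mp hpol
  -- (hsplit) slot splitting, value by value
  have hsplit : ∀ w ∈ V, (∑ c : Fin C, if w ∈ V.filter (fun w => (∃ p q : Fin 6, δ0 p + δ0 q = w ∧ polar (W c p) (W c q) ≠ 0))
      then (if δ0 0 + δ0 0 = w ∧ polar (W c 5) (W c 5) ≠ 0 then 2 else if (∃ q : Fin 6, q ≠ 5 ∧ δ0 5 + δ0 q = w ∧ polar (W c 5) (W c q) ≠ 0) then 1 else 0) else 0) ≤ (if w = δ0 0 + δ0 0 then 3 else if (∃ q : Fin 6, q ≠ 0 ∧ q ≠ 5 ∧ w = δ0 0 + δ0 q) then 2 else 1) - 1 := by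
    intro w hw
    obtain ⟨pq, -, hpqw⟩ := Finset.mem_image.mp hw
    obtain ⟨p₀, q₀⟩ := pq
    simp only at hpqw
    -- the three kinds of values
    have hwl : ∀ r : Fin 6, r = 0 ∨ r = 5 → δ0 r = δ0 0 := by
      rintro r (rfl | rfl)
      · rfl
      · exact h05
    by_cases hA : (p₀ = 0 ∨ p₀ = 5) ∧ (q₀ = 0 ∨ q₀ = 5)
    · -- the triple value `2δ0 0`
      have hw2 : w = δ0 0 + δ0 0 := by rw [← hpqw, hwl p₀ hA.1, hwl q₀ hA.2]
      subst hw2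
      rw [if_pos rfl]
      refine (sum_le_two_of_rules _ ?_ ?_ ?_).trans (by norm_num)
      · intro c
        split_ifs <;> omega
      · intro c c' hcc' hfc
        -- `f c = 2`: the `t²`-slot is alive at `c`
        have h55 : Γ c 5 5 ≠ 0 := by
          by_contra h55
          have hp55 : ¬ (δ0 0 + δ0 0 = δ0 0 + δ0 0 ∧ polar (W c 5) (W c 5) ≠ 0) := fun h => ((hal c 5 5).mp h.2) h55
          rw [if_neg hp55] at hfc
          (split_ifs at hfc; omega)
        -- at `c'` both confluent triple slots are dead
        have hdead : Γ c' 5 5 = 0 ∧ Γ c' 0 5 = 0 := by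
          rcases lt_or_gt_of_ne hcc' with hlt | hgt
          · exact Rtop c c' hlt h55
          · constructor
            · by_contra h'
              exact h55 (Rtop c' c hgt h').1
            · by_contra h'
              exact h55 (Rmid c' c hgt h')
        have hn55 : ¬ (δ0 0 + δ0 0 = δ0 0 + δ0 0 ∧ polar (W c' 5) (W c' 5) ≠ 0) := fun h => ((hal c' 5 5).mp h.2) hdead.1
        have hn05 : ¬ (∃ q : Fin 6, q ≠ 5 ∧ δ0 5 + δ0 q = δ0 0 + δ0 0 ∧ polar (W c' 5) (W c' q) ≠ 0) := fun h => hq0 c' h hdead.2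
        rw [if_neg hn55, if_neg hn05, ite_self]
      · intro c₁ c₂ c₃ h12 h23 hf1 hf2 hf3
        -- `f c = 1`: the `t`-slot `(0,5)` is alive at `c`
        have h05' : ∀ c : Fin C, (if δ0 0 + δ0 0 ∈ V.filter (fun w => (∃ p q : Fin 6, δ0 p + δ0 q = w ∧ polar (W c p) (W c q) ≠ 0))
            then (if δ0 0 + δ0 0 = δ0 0 + δ0 0 ∧ polar (W c 5) (W c 5) ≠ 0 then 2 else if (∃ q : Fin 6, q ≠ 5 ∧ δ0 5 + δ0 q = δ0 0 + δ0 0 ∧ polar (W c 5) (W c q) ≠ 0) then 1 else 0) else 0) = 1 → Γ c 0 5 ≠ 0 := by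
          intro c hfc
          by_cases hmem : δ0 0 + δ0 0 ∈ V.filter (fun w => (∃ p q : Fin 6, δ0 p + δ0 q = w ∧ polar (W c p) (W c q) ≠ 0))
          · rw [if_pos hmem] at hfc
            by_cases h1 : δ0 0 + δ0 0 = δ0 0 + δ0 0 ∧ polar (W c 5) (W c 5) ≠ 0
            · rw [if_pos h1] at hfc; norm_num at hfc
            · rw [if_neg h1] at hfc
              by_cases h2 : ∃ q : Fin 6, q ≠ 5 ∧ δ0 5 + δ0 q = δ0 0 + δ0 0 ∧ polar (W c 5) (W c q) ≠ 0
              · exact hq0 c h2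
              · rw [if_neg h2] at hfc; norm_num at hfc
          · rw [if_neg hmem] at hfc; norm_num at hfc
        exact Rthree c₁ c₂ c₃ h12 h23 (h05' c₁ hf1) (h05' c₂ hf2) (h05' c₃ hf3)
    · by_cases hB : (p₀ = 0 ∨ p₀ = 5) ∨ (q₀ = 0 ∨ q₀ = 5)
      · -- a doubleton value `δ0 0 + δ0 q'`, `q' ∉ {0,5}`
        obtain ⟨q', hq'0, hq'5, hwq'⟩ : ∃ q' : Fin 6, q' ≠ 0 ∧ q' ≠ 5 ∧ w = δ0 0 + δ0 q' := by
          rcases hB with hp | hq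
          · have hq : ¬ (q₀ = 0 ∨ q₀ = 5) := fun hq => hA ⟨hp, hq⟩
            push Not at hq
            exact ⟨q₀, hq.1, hq.2, by rw [← hpqw, hwl p₀ hp]⟩
          · have hp : ¬ (p₀ = 0 ∨ p₀ = 5) := fun hp => hA ⟨hp, hq⟩
            push Not at hp
            exact ⟨p₀, hp.1, hp.2, by rw [← hpqw, hwl q₀ hq, add_comm]⟩
        subst hwq'
        have hnot2 : ¬ (δ0 0 + δ0 q' = δ0 0 + δ0 0) := fun h =>
          hq'0 (weyl_pos_inj δ0 hsid 0 q' (by decide) hq'5 (by linarith))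
        have hnot2' : ¬ (δ0 0 + δ0 0 = δ0 0 + δ0 q') := fun h => hnot2 h.symm
        rw [if_neg hnot2, if_pos ⟨q', hq'0, hq'5, rfl⟩]
        refine (sum_le_one_of_pairwise _ ?_ ?_).trans (by norm_num)
        · intro c
          have : ¬ (δ0 0 + δ0 0 = δ0 0 + δ0 q' ∧ polar (W c 5) (W c 5) ≠ 0) := fun h => hnot2' h.1
          rw [if_neg this]
          split_ifs <;> omega
        · -- two clusters with the `t`-slot `(5,q')` alive
          have hx : ∀ c : Fin C, (if δ0 0 + δ0 q' ∈ V.filter (fun w => (∃ p q : Fin 6, δ0 p + δ0 q = w ∧ polar (W c p) (W c q) ≠ 0))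
              then (if δ0 0 + δ0 0 = δ0 0 + δ0 q' ∧ polar (W c 5) (W c 5) ≠ 0 then 2 else if (∃ q : Fin 6, q ≠ 5 ∧ δ0 5 + δ0 q = δ0 0 + δ0 q' ∧ polar (W c 5) (W c q) ≠ 0) then 1 else 0) else 0) = 1 → Γ c 5 q' ≠ 0 := by
            intro c hfc
            by_cases hmem : δ0 0 + δ0 q' ∈ V.filter (fun w => (∃ p q : Fin 6, δ0 p + δ0 q = w ∧ polar (W c p) (W c q) ≠ 0))
            · rw [if_pos hmem] at hfc
              have h1 : ¬ (δ0 0 + δ0 0 = δ0 0 + δ0 q' ∧ polar (W c 5) (W c 5) ≠ 0) := fun h => hnot2' h.1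
              rw [if_neg h1] at hfc
              by_cases h2 : ∃ q : Fin 6, q ≠ 5 ∧ δ0 5 + δ0 q = δ0 0 + δ0 q' ∧ polar (W c 5) (W c q) ≠ 0
              · obtain ⟨q, hq5, hq, hpol⟩ := h2
                have hqq : q = q' := weyl_pos_inj δ0 hsid q' q hq'5 hq5 (by rw [h05] at hq; linarith)
                subst hqq
                exact (hal c 5 q).mp hpol
              · rw [if_neg h2] at hfc; norm_num at hfc
            · rw [if_neg hmem] at hfc; norm_num at hfc
          intro c c' hcc' h1 h2
          exact Rdbl c c' hcc' q' hq'0 hq'5 (hx c h1) (hx c' h2)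
      · -- a singleton value: every degree is `0`
        push Not at hA hB
        obtain ⟨⟨hp0, hp5⟩, hq0', hq5'⟩ := hB
        have hzero : ∀ c : Fin C, (if w ∈ V.filter (fun w => (∃ p q : Fin 6, δ0 p + δ0 q = w ∧ polar (W c p) (W c q) ≠ 0))
            then (if δ0 0 + δ0 0 = w ∧ polar (W c 5) (W c 5) ≠ 0 then 2 else if (∃ q : Fin 6, q ≠ 5 ∧ δ0 5 + δ0 q = w ∧ polar (W c 5) (W c q) ≠ 0) then 1 else 0) else 0) = 0 := by
          intro c
          have h1 : ¬ (δ0 0 + δ0 0 = w ∧ polar (W c 5) (W c 5) ≠ 0) := fun h =>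
            weyl_triple_value δ0 h05 hsid p₀ q₀ hq0' hq5' (by rw [h.1, hpqw])
          have h2 : ¬ (∃ q : Fin 6, q ≠ 5 ∧ δ0 5 + δ0 q = w ∧ polar (W c 5) (W c q) ≠ 0) := fun ⟨q, hq5, hq, _⟩ =>
            weyl_singleton_value δ0 h05 hsid p₀ q₀ q hp0 hp5 hq0' hq5' hq5 (by rw [hq, hpqw])
          rw [if_neg h1, if_neg h2, ite_self]
        rw [Finset.sum_eq_zero (fun c _ => hzero c)]
        exact Nat.zero_le _
  -- the ceiling, |V| = 15, and the equality case
  have hcc := chain_ceiling V (fun w => (if w = δ0 0 + δ0 0 then 3 else if (∃ q : Fin 6, q ≠ 0 ∧ q ≠ 5 ∧ w = δ0 0 + δ0 q) then 2 else 1))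
    (fun c => V.filter (fun w => (∃ p q : Fin 6, δ0 p + δ0 q = w ∧ polar (W c p) (W c q) ≠ 0)))
    (fun c w => (if δ0 0 + δ0 0 = w ∧ polar (W c 5) (W c 5) ≠ 0 then 2 else if (∃ q : Fin 6, q ≠ 5 ∧ δ0 5 + δ0 q = w ∧ polar (W c 5) (W c q) ≠ 0) then 1 else 0)) m
    hne' (fun c => Finset.filter_subset _ _) hmono' hsplit hcount
  have hVcard : V.card = 15 := by
    beta_reduce at hcc
    omega
  obtain ⟨k1, k2, k3⟩ := chain_ceiling_tight V (fun w => (if w = δ0 0 + δ0 0 then 3 else if (∃ q : Fin 6, q ≠ 0 ∧ q ≠ 5 ∧ w = δ0 0 + δ0 q) then 2 else 1))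
    (fun c => V.filter (fun w => (∃ p q : Fin 6, δ0 p + δ0 q = w ∧ polar (W c p) (W c q) ≠ 0)))
    (fun c w => (if δ0 0 + δ0 0 = w ∧ polar (W c 5) (W c 5) ≠ 0 then 2 else if (∃ q : Fin 6, q ≠ 5 ∧ δ0 5 + δ0 q = w ∧ polar (W c 5) (W c q) ≠ 0) then 1 else 0)) m
    hne' (fun c => Finset.filter_subset _ _) hmono' hsplit hcount (by omega)
  refine ⟨φ, hφ, C, m, s, R, μ, Γ, ε, W, hm, hmpos, hdrift, hzeros, hpkg, hVcard, k1, ?_, ?_, ?_⟩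
  · intro c c' hcc' p q p' q' h1 h2
    exact Rmono c c' hcc' p q p' q' ((hal c p q).mp h1) ((hal c' p' q').mp h2)
  · rw [hVcard] at k3
    omega
  · intro w hw
    refine Eq.trans (Finset.sum_congr rfl fun c _ => ?_) (k2 w hw)
    by_cases hAl : (∃ p q : Fin 6, δ0 p + δ0 q = w ∧ polar (W c p) (W c q) ≠ 0)
    · have hmem : w ∈ V.filter (fun w => (∃ p q : Fin 6, δ0 p + δ0 q = w ∧ polar (W c p) (W c q) ≠ 0)) := Finset.mem_filter.mpr ⟨hw, hAl⟩
      rw [if_pos hAl, if_pos hmem]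
    · have hmem : ¬ w ∈ V.filter (fun w => (∃ p q : Fin 6, δ0 p + δ0 q = w ∧ polar (W c p) (W c q) ≠ 0)) := fun h => hAl (Finset.mem_filter.mp h).2
      rw [if_neg hAl, if_neg hmem]

end Summit.ValiantsHypothesis.ValiantsHypothesis.Theorems.LacunarySymmetroidMatrixDescartes.WallBubbling
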